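import Mathlib
import Literature.Analysis.ValidatedNumerics.PolySignCells
import Summits.Ventures.FusionMHD.Models.TearingFRS1EqSigmaM4N2
import HarnessLib

/-!
# F3.σ rider «#66‴ σ4» — certificate DATA 3/3: `posCells` chunk 3 and `N > 0` on `[0, 1]`

Companion DATA of `Models/TearingFRS1EqSigmaM4.lean` (statement, model and provenance there; seat `gridfusion-sos-6` g4; generator
`HOME/cert/sos-6/sigma/{ratcert_eq.py, emit_rat_eq.py, split_eq4b.py}`).  The 90-cell `posCells` cover of the degree-68 cleared polynomial `N`
(σ = 1/10000, force-balanced FRS1 model) is split in three kernel checks of 30 cells, one per file (lead 11:20Z: «cells ≲ 50 per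
decide at cleared degree ≲ 60»; measured: 45 cells × 90-digit integers exceed one decide's budget).  SIGN FACTS ONLY; nothing here is a
stability statement.  [instance data]
-/

noncomputable section

open Set
open Literature.Analysis.ValidatedNumerics.ExpPoly

namespace Summit.Ventures.FusionMHD.Models

namespace TearingFRS1

namespace EqSigmaR5

/-- Breakpoints of chunk 3 of the `posCells` cover: cells of `[87/128, 1]` (30 cells). [instance data] -/
def mid3Eq4 : List ℚ := [((175 : ℚ) / 256), ((11 : ℚ) / 16), ((177 : ℚ) / 256), ((89 : ℚ) / 128), ((179 : ℚ) / 256), ((45 : ℚ) / 64), ((181 : ℚ) / 256), ((91 : ℚ) / 128), ((23 : ℚ) / 32), ((93 : ℚ) / 128), ((47 : ℚ) / 64), ((95 : ℚ) / 128), ((3 : ℚ) / 4), ((97 : ℚ) / 128), ((49 : ℚ) / 64), ((99 : ℚ) / 128), ((25 : ℚ) / 32), ((51 : ℚ) / 64), ((13 : ℚ) / 16), ((53 : ℚ) / 64), ((27 : ℚ) / 32), ((55 : ℚ) / 64), ((7 : ℚ) / 8), ((29 : ℚ) / 32), ((15 : ℚ) / 16), ((31 : ℚ) / 32), ((63 :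 ℚ) / 64), ((127 : ℚ) / 128), ((255 : ℚ) / 256)]

set_option maxRecDepth 100000 in
/-- Kernel check `N > 0` on the cells of `[87/128, 1]`. [instance data] -/
theorem NEq4_posCells3 : Poly.posCells NEq4 (((87 : ℚ) / 128) :: (mid3Eq4 ++ [(1 : ℚ)])) = true := by
  decide +kernel

/-- `N > 0` on `[0, 1]` (three chunks). [instance data] -/
theorem NEq4_pos {r : ℝ} (h0 : (0 : ℝ) ≤ r) (h1 : r ≤ 1) : 0 < Poly.eval NEq4 r := by
  rcases le_or_gt r ((((327 : ℚ) / 512) : ℚ) : ℝ) with ha | ha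
  · exact Poly.pos_of_posCells NEq4_posCells1 (by exact_mod_cast h0) ha
  rcases le_or_gt r ((((87 : ℚ) / 128) : ℚ) : ℝ) with hb | hb
  · exact Poly.pos_of_posCells NEq4_posCells2 ha.le hb
  · exact Poly.pos_of_posCells NEq4_posCells3 hb.le (by exact_mod_cast h1)

end EqSigmaR5

end TearingFRS1

end Summit.Ventures.FusionMHD.Models

end
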